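import Literature.Analysis.FluidPDE.PineauVicolPressureDuality
import Literature.Analysis.FluidPDE.NormalisedPressureDischarge
import Literature.Analysis.FluidPDE.ClassicalSolutionGlue
import HarnessLib

/-!
# The pressure of a classical Type I solution is the Riesz pressure (Pineau–Vicol 2026, Lemma 2.1 / 7.1)

Analysis/FluidPDE support file (all results proved; no named facts), third of the pressure files
in the discharge programme of `Literature.Analysis.FluidPDE.pineauVicol2026_rdss_liouville`
(B. Pineau, V. Vicol, arXiv:2607.09619 (2026), Thm. 1.7). The vendored Theorem 1.7 (and 1.4)
take ANY smooth pressure with the classical equations on `[−1, 0)`; the printed proofs use the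
representation `P = RᵢRⱼ(UⁱUʲ)` ("+ a function of time, WLOG zero", Lemma 7.1). This file derives
that representation from the Type I bound alone: **`∇p(t) = ∇Q[u(t)]` for every `t ∈ (−1, 0)`**
(`gradient_pressure_eq_of_typeI`), `Q` the tree's pressure potential — Tao's pressure
normalisation (Tao 2011, Lemma 4.1 (i); tree `tao_pressure_normalisation_holds` for finite
energy) carried out on the infinite-energy decay class `(1+|y|)|u(t,y)| ≤ C`:

* weighted local `L¹` bounds on the decay class (`setIntegral_closedBall_inv_one_add_norm_le`:
  `∫_{B̄_ρ}(1+|z|)⁻¹ ≤ 4πρ²N₁` by comparison with `|Γ₀^{ρ,2ρ}|`; `integral_abs_mul_norm_le_decay`,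
  `integral_abs_mul_norm_sq_le_decay`, Peetre `inv_one_add_norm_le_peetre`) replacing the energy
  lemma `integral_abs_mul_norm_le` of `NormalisedPressureDischarge`;
* the four probe bounds, all `O(1/R)` with constants depending on the probe point `x₀`:
  `exists_bound_probe_laplacian_decay` (`O(C R⁻³)`), `_transport_decay` (`O(C²R⁻²)`),
  `_boundary_decay` (`O(C R⁻¹)`), `_potential_decay` (`O(C²R⁻¹)`, from
  `PineauVicolPressureDuality.exists_abs_integral_pressurePotential_mul_le_decay`);
* `harmonicOnNhd_pressure_sub_pressurePotential_decay`, the probe identity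
  `fderiv_harmonicPart_eq_decay` (the finite-energy proof verbatim — its only uses of the energy
  were the `C²` regularity of `Q` and the harmonicity of `h = p − Q`, now from
  `PineauVicolPressureDecayClass`), `fderiv_harmonicPart_eq_zero_decay` (uniqueness lemma of
  `HarmonicProbe`), `pressure_sub_pressurePotential_eq_decay`,
  `gradient_pressure_eq_gradient_pressurePotential_decay` (solutions on `[0, T]`), and the
  application `gradient_pressure_eq_of_typeI` (time translation of `[ (t−1)/2, t/2 ]`).

## References

* B. Pineau, V. Vicol, arXiv:2607.09619 (2026), Lemma 2.1 (pp. 9–10), Lemma 7.1 (pp. 23–24).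
  [PineauVicol2026]
* T. Tao, *Localisation and compactness properties of the Navier–Stokes global regularity
  problem*, Anal. PDE 6 (2013), §4, Lemma 4.1 (i) and its proof. [Tao2011]
-/

noncomputable section

open MeasureTheory Set Filter Metric Topology InnerProductSpace Function
open scoped RealInnerProductSpace Laplacian ContDiff ENNReal

namespace Literature.Analysis.FluidPDE

namespace PineauVicol2026

/-- Local notation for physical space `ℝ³ = EuclideanSpace ℝ (Fin 3)`. -/
local notation "ℝ³" => EuclideanSpace ℝ (Fin 3)

/-! ### Weighted local `L¹` bounds on the decay class -/

/-- **`∫_{B̄(0,ρ)} (1+|z|)⁻¹ dz ≤ 4π ρ² N₁`** with `N₁ = ∫|Γ₀^{1,2}|`: on the ball,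
`(1+|z|)⁻¹ ≤ |z|⁻¹ = 4π|Γ₀^{ρ,2ρ}(z)|`, and `∫|Γ₀^{ρ,2ρ}| = ρ²∫|Γ₀^{1,2}|`. [folklore] -/
theorem setIntegral_closedBall_inv_one_add_norm_le {ρ : ℝ} (hρ : 0 < ρ) :
    ∫ z in closedBall (0 : ℝ³) ρ, (1 + ‖z‖)⁻¹ ≤
      4 * Real.pi * (ρ ^ 2 * ∫ w, |newtonNear (1 : ℝ) 2 w|) := by
  have hρ1 : (0 : ℝ) ≤ ρ * 1 := by linarith
  have hρ2 : ρ * 1 < ρ * 2 := by linarith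
  have hint : Integrable fun z => |newtonNear (ρ * 1) (ρ * 2) z| := (integrable_newtonNear hρ1 hρ2).abs
  have hpt : ∀ z, z ≠ 0 → (closedBall (0 : ℝ³) ρ).indicator (fun z => (1 + ‖z‖)⁻¹) z ≤
      4 * Real.pi * |newtonNear (ρ * 1) (ρ * 2) z| := by
    intro z hz0
    by_cases hz : z ∈ closedBall (0 : ℝ³) ρ
    · rw [Set.indicator_of_mem hz]
      have hzρ : ‖z‖ ≤ ρ * 1 := by simpa [mem_closedBall_zero_iff] using hz
      rw [newtonNear_eq_newtonKernel hρ1 hρ2 hzρ, abs_newtonKernel]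
      have hzpos : 0 < ‖z‖ := norm_pos_iff.2 hz0
      rw [show 4 * Real.pi * (4 * Real.pi * ‖z‖)⁻¹ = ‖z‖⁻¹ by field_simp]
      exact inv_anti₀ hzpos (by linarith)
    · rw [Set.indicator_of_notMem hz]; positivity
  have hae : ∀ᵐ z ∂(volume : Measure ℝ³), (closedBall (0 : ℝ³) ρ).indicator (fun z => (1 + ‖z‖)⁻¹) z ≤
      4 * Real.pi * |newtonNear (ρ * 1) (ρ * 2) z| := by
    have h0 : (volume : Measure ℝ³) {0} = 0 := measure_singleton 0
    rw [ae_iff]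
    refine measure_mono_null (fun z hz => ?_) h0
    by_contra hne
    exact hz (hpt z hne)
  calc ∫ z in closedBall (0 : ℝ³) ρ, (1 + ‖z‖)⁻¹
      = ∫ z, (closedBall (0 : ℝ³) ρ).indicator (fun z => (1 + ‖z‖)⁻¹) z := (integral_indicator measurableSet_closedBall).symm
    _ ≤ ∫ z, 4 * Real.pi * |newtonNear (ρ * 1) (ρ * 2) z| := by
        refine integral_mono_ae ?_ (hint.const_mul _) hae
        rw [integrable_indicator_iff measurableSet_closedBall]
        exact ((continuous_const.add continuous_norm).inv₀ fun z => (by positivity : (0:ℝ) < 1 + ‖z‖).ne').continuousOn.integrableOn_compact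
          (isCompact_closedBall 0 ρ)
    _ = 4 * Real.pi * (ρ ^ 2 * ∫ w, |newtonNear (1 : ℝ) 2 w|) := by
        rw [integral_const_mul, integral_abs_newtonNear_scale hρ]

/-- Peetre: `(1+|y|)⁻¹ ≤ (1+|x₀|)(1+|y−x₀|)⁻¹`. [folklore] -/
theorem inv_one_add_norm_le_peetre (x₀ y : ℝ³) : (1 + ‖y‖)⁻¹ ≤ (1 + ‖x₀‖) * (1 + ‖y - x₀‖)⁻¹ := by
  have h1 : 0 < 1 + ‖y‖ := by positivity
  have h2 : 0 < 1 + ‖y - x₀‖ := by positivity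
  rw [inv_eq_one_div, ← div_eq_mul_inv, div_le_div_iff₀ h1 h2, one_mul]
  have : ‖y - x₀‖ ≤ ‖y‖ + ‖x₀‖ := norm_sub_le y x₀
  nlinarith [norm_nonneg y, norm_nonneg x₀]

/-- **Weighted local `L¹` bound on the decay class**: if `|g| ≤ c` and `g = 0` off `B̄(x₀, ρ)`,
then for `v` with `(1+|y|)|v(y)| ≤ C`,
`∫ |g| |v| ≤ c C (1+|x₀|) · 4πρ² N₁` (`N₁ = ∫|Γ₀^{1,2}|`). [folklore] -/
theorem integral_abs_mul_norm_le_decay {v : ℝ³ → ℝ³} (hvc : Continuous v) {C : ℝ}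
    (hv : ∀ y, ‖v y‖ ≤ C / (1 + ‖y‖)) {g : ℝ³ → ℝ} (hgc : Continuous g) {c ρ : ℝ} (hc : 0 ≤ c)
    (hρ : 0 < ρ) (x₀ : ℝ³) (hg : ∀ y, |g y| ≤ c) (hg0 : ∀ y, ρ < ‖y - x₀‖ → g y = 0) :
    Integrable (fun y => |g y| * ‖v y‖) ∧
    ∫ y, |g y| * ‖v y‖ ≤ c * C * (1 + ‖x₀‖) * (4 * Real.pi * (ρ ^ 2 * ∫ w, |newtonNear (1 : ℝ) 2 w|)) := by
  have hC : 0 ≤ C := by have := (norm_nonneg _).trans (hv 0); simpa using this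
  set B := closedBall x₀ ρ with hB
  -- the dominator
  set G : ℝ³ → ℝ := fun y => c * C * (1 + ‖x₀‖) * B.indicator (fun y => (1 + ‖y - x₀‖)⁻¹) y with hG
  have hGi : Integrable G := by
    refine Integrable.const_mul ?_ _
    rw [integrable_indicator_iff measurableSet_closedBall]
    exact (((continuous_const.add (continuous_id.sub continuous_const).norm).inv₀
      fun y => (by positivity : (0:ℝ) < 1 + ‖y - x₀‖).ne').continuousOn.integrableOn_compact
      (isCompact_closedBall x₀ ρ))
  have hle : ∀ y, |g y| * ‖v y‖ ≤ G y := by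
    intro y
    by_cases hy : y ∈ B
    · rw [hG]; dsimp only; rw [Set.indicator_of_mem hy]
      calc |g y| * ‖v y‖ ≤ c * (C / (1 + ‖y‖)) := mul_le_mul (hg y) (hv y) (norm_nonneg _) hc
        _ = c * C * (1 + ‖y‖)⁻¹ := by rw [div_eq_mul_inv]; ring
        _ ≤ c * C * ((1 + ‖x₀‖) * (1 + ‖y - x₀‖)⁻¹) :=
            mul_le_mul_of_nonneg_left (inv_one_add_norm_le_peetre x₀ y) (by positivity)
        _ = c * C * (1 + ‖x₀‖) * (1 + ‖y - x₀‖)⁻¹ := by ring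
    · have hy' : ρ < ‖y - x₀‖ := by rwa [hB, mem_closedBall, dist_eq_norm, not_le] at hy
      rw [hg0 y hy', abs_zero, zero_mul, hG]; dsimp only
      rw [Set.indicator_of_notMem hy, mul_zero]
  have hint : Integrable fun y => |g y| * ‖v y‖ :=
    hGi.mono' (hgc.abs.mul hvc.norm).aestronglyMeasurable (Eventually.of_forall fun y => by
      rw [Real.norm_eq_abs, abs_mul, abs_abs, abs_norm]; exact hle y)
  refine ⟨hint, ?_⟩
  have htrans : ∫ y, B.indicator (fun y => (1 + ‖y - x₀‖)⁻¹) y = ∫ z in closedBall (0 : ℝ³) ρ, (1 + ‖z‖)⁻¹ := by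
    have e : (fun y => B.indicator (fun y => (1 + ‖y - x₀‖)⁻¹) y) =
        fun y => (closedBall (0 : ℝ³) ρ).indicator (fun z => (1 + ‖z‖)⁻¹) (y - x₀) := by
      funext y
      by_cases hy : y ∈ B
      · have : y - x₀ ∈ closedBall (0 : ℝ³) ρ := by
          rw [mem_closedBall_zero_iff]; rwa [hB, mem_closedBall, dist_eq_norm] at hy
        rw [Set.indicator_of_mem hy, Set.indicator_of_mem this]
      · have : y - x₀ ∉ closedBall (0 : ℝ³) ρ := by
          rw [mem_closedBall_zero_iff]; rwa [hB, mem_closedBall, dist_eq_norm] at hy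
        rw [Set.indicator_of_notMem hy, Set.indicator_of_notMem this]
    rw [e, integral_sub_right_eq_self (fun z => (closedBall (0 : ℝ³) ρ).indicator (fun z => (1 + ‖z‖)⁻¹) z) x₀,
      integral_indicator measurableSet_closedBall]
  calc ∫ y, |g y| * ‖v y‖ ≤ ∫ y, G y := integral_mono hint hGi hle
    _ = c * C * (1 + ‖x₀‖) * ∫ z in closedBall (0 : ℝ³) ρ, (1 + ‖z‖)⁻¹ := by
        rw [hG]; dsimp only; rw [integral_const_mul, htrans]
    _ ≤ c * C * (1 + ‖x₀‖) * (4 * Real.pi * (ρ ^ 2 * ∫ w, |newtonNear (1 : ℝ) 2 w|)) :=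
        mul_le_mul_of_nonneg_left (setIntegral_closedBall_inv_one_add_norm_le hρ) (by positivity)

/-- The squared variant: `∫ |g| |v|² ≤ c C² (1+|x₀|)² · 4πρ² N₁`. [folklore] -/
theorem integral_abs_mul_norm_sq_le_decay {v : ℝ³ → ℝ³} (hvc : Continuous v) {C : ℝ}
    (hv : ∀ y, ‖v y‖ ≤ C / (1 + ‖y‖)) {g : ℝ³ → ℝ} (hgc : Continuous g) {c ρ : ℝ} (hc : 0 ≤ c)
    (hρ : 0 < ρ) (x₀ : ℝ³) (hg : ∀ y, |g y| ≤ c) (hg0 : ∀ y, ρ < ‖y - x₀‖ → g y = 0) :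
    Integrable (fun y => |g y| * ‖v y‖ ^ 2) ∧
    ∫ y, |g y| * ‖v y‖ ^ 2 ≤ c * C ^ 2 * (1 + ‖x₀‖) ^ 2 * (4 * Real.pi * (ρ ^ 2 * ∫ w, |newtonNear (1 : ℝ) 2 w|)) := by
  -- `|g| |v|² = (|g| |v|) |v|` with the weight `‖v‖ ≤ C (1+|x₀|)/(1+|y−x₀|) ≤ C(1+|x₀|)`... we use
  -- the first lemma with `g' = g ‖v‖`, `|g'| ≤ c C (1+|x₀|)`? No: simpler, `|v y| ≤ C/(1+|y|) ≤ C`.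
  have hC : 0 ≤ C := by have := (norm_nonneg _).trans (hv 0); simpa using this
  have hvC : ∀ y, ‖v y‖ ≤ C := fun y => (hv y).trans (div_le_self hC (by linarith [norm_nonneg y]))
  have hg' : ∀ y, |g y * ‖v y‖| ≤ c * C := fun y => by
    rw [abs_mul, abs_norm]; exact mul_le_mul (hg y) (hvC y) (norm_nonneg _) hc
  have hg0' : ∀ y, ρ < ‖y - x₀‖ → g y * ‖v y‖ = 0 := fun y hy => by rw [hg0 y hy, zero_mul]
  obtain ⟨hi, hI⟩ := integral_abs_mul_norm_le_decay hvc hv (g := fun y => g y * ‖v y‖) (hgc.mul hvc.norm)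
    (by positivity) hρ x₀ hg' hg0'
  have e : (fun y => |g y * ‖v y‖| * ‖v y‖) = fun y => |g y| * ‖v y‖ ^ 2 := by
    funext y; rw [abs_mul, abs_norm]; ring
  rw [e] at hi hI
  refine ⟨hi, hI.trans ?_⟩
  have h1 : (1 : ℝ) ≤ 1 + ‖x₀‖ := by linarith [norm_nonneg x₀]
  set X : ℝ := 4 * Real.pi * (ρ ^ 2 * ∫ w, |newtonNear (1 : ℝ) 2 w|) with hX
  have hX0 : 0 ≤ X := by
    have : 0 ≤ ∫ w, |newtonNear (1 : ℝ) 2 w| := integral_nonneg fun w => abs_nonneg _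
    positivity
  calc c * C * C * (1 + ‖x₀‖) * X = c * C ^ 2 * (1 + ‖x₀‖) * X * 1 := by ring
    _ ≤ c * C ^ 2 * (1 + ‖x₀‖) * X * (1 + ‖x₀‖) := mul_le_mul_of_nonneg_left h1 (by positivity)
    _ = c * C ^ 2 * (1 + ‖x₀‖) ^ 2 * X := by ring

/-! ### The four probe bounds on the decay class (`R ≥ 1`; constants depend on `x₀`, `a`) -/

/-- The common constant `N₁ = ∫|Γ₀^{1,2}|`. [folklore] -/
abbrev newtonNearMass : ℝ := ∫ w, |newtonNear (1 : ℝ) 2 (w : ℝ³)|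

/-- `N₁ ≥ 0`. [folklore] -/
theorem newtonNearMass_nonneg : 0 ≤ newtonNearMass := integral_nonneg fun _ => abs_nonneg _

/-- **Viscous probe term, decay class**: `|∫⟪v, Δφ a⟫| ≤ K (1+|x₀|) C R⁻³` for `R ≥ 1`. [folklore] -/
theorem exists_bound_probe_laplacian_decay (a x₀ : ℝ³) : ∃ K, 0 ≤ K ∧ ∀ (v : ℝ³ → ℝ³) (C : ℝ),
    Continuous v → (∀ y, ‖v y‖ ≤ C / (1 + ‖y‖)) → ∀ (R : ℝ), 1 ≤ R →
      |∫ y, ⟪v y, (Δ (fun y => probeBump R (y - x₀))) y • a⟫| ≤ K * C * R⁻¹ := by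
  obtain ⟨⟨C₁, hC₁⟩, ⟨C₂, hC₂⟩⟩ := exists_bound_baseBump_derivs (E := ℝ³)
  have hC₂0 : 0 ≤ C₂ := (abs_nonneg _).trans (hC₂ 0)
  have hm0 : 0 < baseBumpMass ℝ³ := baseBumpMass_pos
  have hN := newtonNearMass_nonneg
  refine ⟨‖a‖ * ((baseBumpMass ℝ³)⁻¹ * C₂ * (1 + ‖x₀‖) * (16 * Real.pi * newtonNearMass)), by positivity, ?_⟩
  intro v C hvc hv R hR1
  have hR : 0 < R := one_pos.trans_le hR1
  have hC : 0 ≤ C := by have := (norm_nonneg _).trans (hv 0); simpa using this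
  obtain ⟨-, -, -, hΔ, hΔ0⟩ := probeBump_translate_props hR x₀ hC₁ hC₂
  set L := Δ (fun y => probeBump R (y - x₀)) with hL
  have hLc : Continuous L := FluidPDE.continuous_laplacian ((contDiff_probeBump (E := ℝ³) R
    (n := 2)).comp (contDiff_id.sub contDiff_const))
  obtain ⟨hIi, hI⟩ := integral_abs_mul_norm_le_decay hvc hv hLc
    (c := (baseBumpMass ℝ³ * R ^ 3)⁻¹ * R⁻¹ ^ 2 * C₂) (ρ := 2 * R) (by positivity) (by positivity) x₀ hΔ hΔ0
  have hpt : ∀ y, |⟪v y, L y • a⟫| ≤ ‖a‖ * (|L y| * ‖v y‖) := fun y => by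
    rw [inner_smul_right, abs_mul]
    calc |L y| * |⟪v y, a⟫| ≤ |L y| * (‖v y‖ * ‖a‖) := by
          gcongr; exact abs_real_inner_le_norm _ _
      _ = ‖a‖ * (|L y| * ‖v y‖) := by ring
  calc |∫ y, ⟪v y, L y • a⟫| ≤ ∫ y, ‖a‖ * (|L y| * ‖v y‖) := by
        rw [← Real.norm_eq_abs]
        exact norm_integral_le_of_norm_le (hIi.const_mul ‖a‖) (Eventually.of_forall fun y => by
          rw [Real.norm_eq_abs]; exact hpt y)
    _ = ‖a‖ * ∫ y, |L y| * ‖v y‖ := integral_const_mul _ _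
    _ ≤ ‖a‖ * ((baseBumpMass ℝ³ * R ^ 3)⁻¹ * R⁻¹ ^ 2 * C₂ * C * (1 + ‖x₀‖) *
          (4 * Real.pi * ((2 * R) ^ 2 * newtonNearMass))) := mul_le_mul_of_nonneg_left hI (norm_nonneg _)
    _ = ‖a‖ * ((baseBumpMass ℝ³)⁻¹ * C₂ * (1 + ‖x₀‖) * (16 * Real.pi * newtonNearMass)) * C * (R⁻¹ ^ 3) := by
        field_simp; ring
    _ ≤ ‖a‖ * ((baseBumpMass ℝ³)⁻¹ * C₂ * (1 + ‖x₀‖) * (16 * Real.pi * newtonNearMass)) * C * R⁻¹ := by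
        refine mul_le_mul_of_nonneg_left ?_ (by positivity)
        have hRi : R⁻¹ ≤ 1 := inv_le_one_of_one_le₀ hR1
        have hRi0 : 0 ≤ R⁻¹ := by positivity
        calc R⁻¹ ^ 3 = R⁻¹ * (R⁻¹ * R⁻¹) := by ring
          _ ≤ R⁻¹ * (1 * 1) := mul_le_mul_of_nonneg_left (mul_le_mul hRi hRi hRi0 zero_le_one) hRi0
          _ = R⁻¹ := by ring

/-- **Transport probe term, decay class**: `|∫⟪v, (v·∇φ) a⟫| ≤ K (1+|x₀|)² C² R⁻¹`. [folklore] -/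
theorem exists_bound_probe_transport_decay (a x₀ : ℝ³) : ∃ K, 0 ≤ K ∧ ∀ (v : ℝ³ → ℝ³) (C : ℝ),
    Continuous v → (∀ y, ‖v y‖ ≤ C / (1 + ‖y‖)) → ∀ (R : ℝ), 1 ≤ R →
      |∫ y, ⟪v y, fderiv ℝ (fun y => probeBump R (y - x₀)) y (v y) • a⟫| ≤ K * C ^ 2 * R⁻¹ := by
  obtain ⟨⟨C₁, hC₁⟩, ⟨C₂, hC₂⟩⟩ := exists_bound_baseBump_derivs (E := ℝ³)
  have hC₁0 : 0 ≤ C₁ := (norm_nonneg _).trans (hC₁ 0)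
  have hm0 : 0 < baseBumpMass ℝ³ := baseBumpMass_pos
  have hN := newtonNearMass_nonneg
  refine ⟨‖a‖ * ((baseBumpMass ℝ³)⁻¹ * C₁ * (1 + ‖x₀‖) ^ 2 * (16 * Real.pi * newtonNearMass)), by positivity, ?_⟩
  intro v C hvc hv R hR1
  have hR : 0 < R := one_pos.trans_le hR1
  obtain ⟨-, hB0, hD, -, -⟩ := probeBump_translate_props hR x₀ hC₁ hC₂
  set c := (baseBumpMass ℝ³ * R ^ 3)⁻¹ * R⁻¹ * C₁ with hc
  have hc0 : 0 ≤ c := by positivity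
  -- `g := ‖Dφ‖` is continuous, `≤ c`, and vanishes off `B̄(x₀, 2R)`
  have hφ1 : ContDiff ℝ 1 (fun y : ℝ³ => probeBump R (y - x₀)) :=
    (contDiff_probeBump (E := ℝ³) R (n := 1)).comp (contDiff_id.sub contDiff_const)
  have hgc : Continuous fun y => ‖fderiv ℝ (fun y => probeBump R (y - x₀)) y‖ :=
    (hφ1.continuous_fderiv one_ne_zero).norm
  have hg : ∀ y, |‖fderiv ℝ (fun y => probeBump R (y - x₀)) y‖| ≤ c := fun y => by
    rw [abs_norm]; exact hD y
  have hg0 : ∀ y, 2 * R < ‖y - x₀‖ → ‖fderiv ℝ (fun y => probeBump R (y - x₀)) y‖ = 0 := by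
    intro y hy
    rw [norm_eq_zero]
    -- `φ` vanishes on the open set `{2R < |y - x₀|}`, hence so does its derivative
    have hev : (fun y : ℝ³ => probeBump R (y - x₀)) =ᶠ[𝓝 y] fun _ => 0 := by
      have ho : IsOpen {w : ℝ³ | 2 * R < ‖w - x₀‖} := isOpen_lt continuous_const (continuous_id.sub continuous_const).norm
      filter_upwards [ho.mem_nhds hy] with w hw
      exact hB0 w hw
    rw [hev.fderiv_eq]; simp
  obtain ⟨hIi, hI⟩ := integral_abs_mul_norm_sq_le_decay hvc hv hgc hc0 (by positivity : (0:ℝ) < 2 * R) x₀ hg hg0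
  have hpt : ∀ y, |⟪v y, fderiv ℝ (fun y => probeBump R (y - x₀)) y (v y) • a⟫| ≤
      ‖a‖ * (|‖fderiv ℝ (fun y => probeBump R (y - x₀)) y‖| * ‖v y‖ ^ 2) := fun y => by
    rw [inner_smul_right, abs_mul, abs_norm]
    calc |fderiv ℝ (fun y => probeBump R (y - x₀)) y (v y)| * |⟪v y, a⟫|
        ≤ (‖fderiv ℝ (fun y => probeBump R (y - x₀)) y‖ * ‖v y‖) * (‖v y‖ * ‖a‖) := by
          refine mul_le_mul ?_ (abs_real_inner_le_norm _ _) (abs_nonneg _) (by positivity)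
          rw [← Real.norm_eq_abs]; exact ContinuousLinearMap.le_opNorm _ _
      _ = ‖a‖ * (‖fderiv ℝ (fun y => probeBump R (y - x₀)) y‖ * ‖v y‖ ^ 2) := by ring
  calc |∫ y, ⟪v y, fderiv ℝ (fun y => probeBump R (y - x₀)) y (v y) • a⟫|
      ≤ ∫ y, ‖a‖ * (|‖fderiv ℝ (fun y => probeBump R (y - x₀)) y‖| * ‖v y‖ ^ 2) := by
        rw [← Real.norm_eq_abs]
        exact norm_integral_le_of_norm_le (hIi.const_mul _) (Eventually.of_forall fun y => by
          rw [Real.norm_eq_abs]; exact hpt y)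
    _ = ‖a‖ * ∫ y, |‖fderiv ℝ (fun y => probeBump R (y - x₀)) y‖| * ‖v y‖ ^ 2 := integral_const_mul _ _
    _ ≤ ‖a‖ * (c * C ^ 2 * (1 + ‖x₀‖) ^ 2 * (4 * Real.pi * ((2 * R) ^ 2 * newtonNearMass))) :=
        mul_le_mul_of_nonneg_left hI (norm_nonneg _)
    _ = ‖a‖ * ((baseBumpMass ℝ³)⁻¹ * C₁ * (1 + ‖x₀‖) ^ 2 * (16 * Real.pi * newtonNearMass)) * C ^ 2 * R⁻¹ ^ 2 := by
        rw [hc]; field_simp; ring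
    _ ≤ ‖a‖ * ((baseBumpMass ℝ³)⁻¹ * C₁ * (1 + ‖x₀‖) ^ 2 * (16 * Real.pi * newtonNearMass)) * C ^ 2 * R⁻¹ := by
        refine mul_le_mul_of_nonneg_left ?_ (by positivity)
        have hRi : R⁻¹ ≤ 1 := inv_le_one_of_one_le₀ hR1
        have hRi0 : 0 ≤ R⁻¹ := by positivity
        nlinarith

/-- **Boundary probe term, decay class**: `|∫⟪v, φ a⟫| ≤ K (1+|x₀|) C R⁻¹`. [folklore] -/
theorem exists_bound_probe_boundary_decay (a x₀ : ℝ³) : ∃ K, 0 ≤ K ∧ ∀ (v : ℝ³ → ℝ³) (C : ℝ),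
    Continuous v → (∀ y, ‖v y‖ ≤ C / (1 + ‖y‖)) → ∀ (R : ℝ), 1 ≤ R →
      |∫ y, ⟪v y, probeBump R (y - x₀) • a⟫| ≤ K * C * R⁻¹ := by
  obtain ⟨⟨C₁, hC₁⟩, ⟨C₂, hC₂⟩⟩ := exists_bound_baseBump_derivs (E := ℝ³)
  have hm0 : 0 < baseBumpMass ℝ³ := baseBumpMass_pos
  have hN := newtonNearMass_nonneg
  refine ⟨‖a‖ * ((baseBumpMass ℝ³)⁻¹ * (1 + ‖x₀‖) * (16 * Real.pi * newtonNearMass)), by positivity, ?_⟩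
  intro v C hvc hv R hR1
  have hR : 0 < R := one_pos.trans_le hR1
  obtain ⟨hB, hB0, -, -, -⟩ := probeBump_translate_props hR x₀ hC₁ hC₂
  have hφc : Continuous fun y => probeBump R (y - x₀) :=
    (contDiff_probeBump (E := ℝ³) R (n := 0)).continuous.comp (continuous_id.sub continuous_const)
  obtain ⟨hIi, hI⟩ := integral_abs_mul_norm_le_decay hvc hv hφc
    (c := (baseBumpMass ℝ³ * R ^ 3)⁻¹) (ρ := 2 * R) (by positivity) (by positivity) x₀ hB hB0
  have hpt : ∀ y, |⟪v y, probeBump R (y - x₀) • a⟫| ≤ ‖a‖ * (|probeBump R (y - x₀)| * ‖v y‖) :=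
    fun y => by
    rw [inner_smul_right, abs_mul]
    calc |probeBump R (y - x₀)| * |⟪v y, a⟫| ≤ |probeBump R (y - x₀)| * (‖v y‖ * ‖a‖) := by
          gcongr; exact abs_real_inner_le_norm _ _
      _ = ‖a‖ * (|probeBump R (y - x₀)| * ‖v y‖) := by ring
  calc |∫ y, ⟪v y, probeBump R (y - x₀) • a⟫| ≤ ∫ y, ‖a‖ * (|probeBump R (y - x₀)| * ‖v y‖) := by
        rw [← Real.norm_eq_abs]
        exact norm_integral_le_of_norm_le (hIi.const_mul ‖a‖) (Eventually.of_forall fun y => by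
          rw [Real.norm_eq_abs]; exact hpt y)
    _ = ‖a‖ * ∫ y, |probeBump R (y - x₀)| * ‖v y‖ := integral_const_mul _ _
    _ ≤ ‖a‖ * ((baseBumpMass ℝ³ * R ^ 3)⁻¹ * C * (1 + ‖x₀‖) * (4 * Real.pi * ((2 * R) ^ 2 * newtonNearMass))) :=
        mul_le_mul_of_nonneg_left hI (norm_nonneg _)
    _ = ‖a‖ * ((baseBumpMass ℝ³)⁻¹ * (1 + ‖x₀‖) * (16 * Real.pi * newtonNearMass)) * C * R⁻¹ := by
        field_simp; ring

/-- **Potential probe term, decay class**: `|∫ ∂ₐχ_R(z) Q[v](x₀ − z) dz| ≤ K C² R⁻¹` for `R ≥ 1`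
(the duality bound `exists_abs_integral_pressurePotential_mul_le_decay` at scale `R`, times
the normalisation `R⁻⁴` of `∂ₐχ_R`). [cite: Tao2011, §4, proof of Lemma 4.1 (i)] -/
theorem exists_bound_probe_potential_decay (a : ℝ³) : ∃ K, 0 ≤ K ∧ ∀ (v : ℝ³ → ℝ³) (C : ℝ),
    ContDiff ℝ 2 v → (∀ y, ‖v y‖ ≤ C / (1 + ‖y‖)) → ∀ (R : ℝ), 1 ≤ R → ∀ x₀ : ℝ³,
      |∫ z, fderiv ℝ (probeBump R) z a * pressurePotential v (x₀ - z)| ≤ K * C ^ 2 * R⁻¹ := by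
  set m := baseBumpMass ℝ³ with hm
  have hm0 : 0 < m := baseBumpMass_pos
  -- the fixed test function `ψ(s) = m⁻¹ ∂ₐθ(-s)`
  set ψ : ℝ³ → ℝ := fun s => m⁻¹ * fderiv ℝ baseBump (-s) a with hψ
  have hψs : ContDiff ℝ 2 ψ :=
    contDiff_const.mul ((((contDiff_baseBump (E := ℝ³) (n := 3)).fderiv_right (m := 2)
      (by norm_num)).comp contDiff_neg).clm_apply contDiff_const)
  have hψc : HasCompactSupport ψ := by
    have h1 : HasCompactSupport fun s : ℝ³ => fderiv ℝ baseBump (-s) a :=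
      ((hasCompactSupport_baseBump (E := ℝ³)).fderiv_apply (𝕜 := ℝ) a).comp_homeomorph
        (Homeomorph.neg ℝ³)
    exact h1.mul_left
  obtain ⟨M, hM0, hM⟩ := exists_abs_integral_pressurePotential_mul_le_decay hψs hψc
  refine ⟨M, hM0, ?_⟩
  intro v C hv2 hv R hR1 x₀
  have hR : 0 < R := one_pos.trans_le hR1
  have hd : Module.finrank ℝ ℝ³ = 3 := finrank_euclideanSpace_fin
  -- rewrite the probe integral as `R⁻⁴ ∫ Q ψ_R`
  have hker : ∀ y, fderiv ℝ (probeBump R) (x₀ - y) a = R⁻¹ ^ 4 * ψ (R⁻¹ • (y - x₀)) := by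
    intro y
    rw [fderiv_probeBump_apply hR, hd, hψ]
    simp only [smul_sub, neg_sub]
    rw [← hm]
    field_simp
  have e1 : ∫ z, fderiv ℝ (probeBump R) z a * pressurePotential v (x₀ - z) =
      R⁻¹ ^ 4 * ∫ y, pressurePotential v y * ψ (R⁻¹ • (y - x₀)) := by
    rw [← integral_sub_left_eq_self
      (fun z => fderiv ℝ (probeBump R) z a * pressurePotential v (x₀ - z)) volume x₀,
      ← integral_const_mul]
    refine integral_congr_ae (Eventually.of_forall fun y => ?_)
    simp only [sub_sub_cancel, hker y]
    ring
  rw [e1, abs_mul, abs_of_pos (by positivity : (0 : ℝ) < R⁻¹ ^ 4)]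
  calc R⁻¹ ^ 4 * |∫ y, pressurePotential v y * ψ (R⁻¹ • (y - x₀))|
      ≤ R⁻¹ ^ 4 * (M * C ^ 2 * R ^ 3) := mul_le_mul_of_nonneg_left (hM v C hv2 hv x₀ R hR1) (by positivity)
    _ = M * C ^ 2 * R⁻¹ := by field_simp

/-! ### The harmonic part of the pressure and the probe identity (decay class) -/

variable {ν T : ℝ} {u : ℝ → ℝ³ → ℝ³} {p : ℝ → ℝ³ → ℝ}

/-- For a classical solution of the unforced system whose slice at an interior time obeys the
decay `(1+|y|)|u(t,y)| ≤ C` (Type I class; infinite energy allowed), the harmonic part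
`h(t) = p(t) − Q[u(t)]` of the pressure is harmonic on `ℝ³` (as the finite-energy
`harmonicOnNhd_pressure_sub_pressurePotential`, with `laplacian_pressurePotential_decay`).
[cite: Tao2011, §4, proof of Lemma 4.1 (i)] -/
theorem harmonicOnNhd_pressure_sub_pressurePotential_decay
    (h : FluidPDE.IsClassicalNSSolutionOn (Icc 0 T) ν 0 u p) {t : ℝ} (ht : t ∈ Ioo 0 T)
    {C : ℝ} (hdec : ∀ y, ‖u t y‖ ≤ C / (1 + ‖y‖)) :
    HarmonicOnNhd (fun x => p t x - pressurePotential (u t) x) univ := by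
  have htI : t ∈ Icc 0 T := Ioo_subset_Icc_self ht
  have hu : ContDiff ℝ ∞ (u t) := h.contDiff_velocity htI
  have hp : ContDiff ℝ ∞ (p t) := h.contDiff_pressure htI
  have hu4 : ContDiff ℝ 4 (u t) := contDiff_infty.1 hu 4
  have hp2 : ContDiff ℝ 2 (p t) := contDiff_infty.1 hp 2
  have hQ2 : ContDiff ℝ 2 (pressurePotential (u t)) := contDiff_pressurePotential_decay hu4 hdec
  have hη2 : ContDiff ℝ 2 fun x => p t x - pressurePotential (u t) x := hp2.sub hQ2
  have hti : t ∈ interior (Icc 0 T) := by rwa [interior_Icc]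
  have hΔ : ∀ x, Δ (fun x => p t x - pressurePotential (u t) x) x = 0 := fun x => by
    have e : (fun x => p t x - pressurePotential (u t) x) = p t - pressurePotential (u t) := rfl
    rw [e, hp2.contDiffAt.laplacian_sub hQ2.contDiffAt, laplacian_pressurePotential_decay hu4 hdec x,
      laplacian_pressure_eq_of_isClassicalNSSolutionOn h hti x,
      pressureSource_eq_of_isDivFree (h.divFree t htI)]
    have : VectorCalculus.divergence ((0 : ℝ → ℝ³ → ℝ³) t) x = 0 := by
      simp [VectorCalculus.divergence]
    rw [this]
    ring
  intro x _
  exact ⟨hη2.contDiffAt, Eventually.of_forall hΔ⟩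

/-- **The probe identity on the decay class** (verbatim the finite-energy
`fderiv_harmonicPart_eq`, whose only uses of the energy are the `C²` regularity of `Q[u(t)]` and
the harmonicity of `h(t)`, here supplied by the decay-class lemmas):
`∂ₐh(t, x₀) = ν ∫ ⟪u, Δφ a⟫ + ∫ ⟪u, (u·∇φ) a⟫ - ∫ ⟪∂ₜu, φ a⟫ - ∫ ∂ₐχ_R(z) Q[u(t)](x₀ - z) dz`,
`φ = χ_R(· − x₀)`. [cite: Tao2011, §4, proof of Lemma 4.1 (i)] -/
theorem fderiv_harmonicPart_eq_decay (h : FluidPDE.IsClassicalNSSolutionOn (Icc 0 T) ν 0 u p) {t : ℝ}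
    (ht : t ∈ Ioo 0 T) {C : ℝ} (hdec : ∀ y, ‖u t y‖ ≤ C / (1 + ‖y‖)) {R : ℝ} (hR : 0 < R)
    (x₀ a : ℝ³) :
    fderiv ℝ (fun x => p t x - pressurePotential (u t) x) x₀ a =
      ν * (∫ y, ⟪u t y, (Δ (fun y => probeBump R (y - x₀))) y • a⟫)
      + (∫ y, ⟪u t y, fderiv ℝ (fun y => probeBump R (y - x₀)) y (u t y) • a⟫)
      - (∫ y, ⟪FluidPDE.timeDerivWithin (Icc 0 T) u t y, probeBump R (y - x₀) • a⟫)
      - ∫ z, fderiv ℝ (probeBump R) z a * pressurePotential (u t) (x₀ - z) := by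
  haveI : CompleteSpace ℝ³ := inferInstance
  have hT : 0 < T := ht.1.trans ht.2
  have hS : UniqueDiffOn ℝ (Icc 0 T) := uniqueDiffOn_Icc hT
  have htI : t ∈ Icc 0 T := Ioo_subset_Icc_self ht
  -- regularity of the slices
  have hu : ContDiff ℝ ∞ (u t) := h.contDiff_velocity htI
  have hp : ContDiff ℝ ∞ (p t) := h.contDiff_pressure htI
  have hu4 : ContDiff ℝ 4 (u t) := contDiff_infty.1 hu 4
  have hu2 : ContDiff ℝ 2 (u t) := contDiff_infty.1 hu 2
  have hu1 : ContDiff ℝ 1 (u t) := contDiff_infty.1 hu 1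
  have hp1 : ContDiff ℝ 1 (p t) := contDiff_infty.1 hp 1
  have huc : Continuous (u t) := hu.continuous
  set Q := pressurePotential (u t) with hQ_def
  have hQ2 : ContDiff ℝ 2 Q := contDiff_pressurePotential_decay hu4 hdec
  have hQc : Continuous Q := hQ2.continuous
  have hη := harmonicOnNhd_pressure_sub_pressurePotential_decay h ht hdec
  -- the bump, its translate and the vector test field
  set χ : ℝ³ → ℝ := probeBump R with hχ_def
  have hχs : ContDiff ℝ ∞ χ := contDiff_probeBump R
  have hχ1 : ContDiff ℝ 1 χ := contDiff_infty.1 hχs 1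
  have hχc : HasCompactSupport χ := hasCompactSupport_probeBump hR
  set φ : ℝ³ → ℝ := fun y => χ (y - x₀) with hφ_def
  have hφs : ContDiff ℝ ∞ φ := hχs.comp (contDiff_id.sub contDiff_const)
  have hφ2 : ContDiff ℝ 2 φ := contDiff_infty.1 hφs 2
  have hφ1 : ContDiff ℝ 1 φ := contDiff_infty.1 hφs 1
  have hφc : HasCompactSupport φ := by
    have e : φ = χ ∘ Homeomorph.addRight (-x₀) := by
      funext y; simp [hφ_def, sub_eq_add_neg]
    rw [e]
    exact hχc.comp_homeomorph _
  have hφχ : ∀ y, χ (x₀ - y) = φ y := fun y => by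
    simp only [hφ_def, hχ_def]
    rw [← probeBump_neg R (y - x₀), neg_sub]
  set Ψ : ℝ³ → ℝ³ := fun y => φ y • a with hΨ_def
  have hΨ2 : ContDiff ℝ 2 Ψ := hφ2.smul contDiff_const
  have hΨ1 : ContDiff ℝ 1 Ψ := hφ1.smul contDiff_const
  have hΨc : HasCompactSupport Ψ := hφc.smul_right (f' := fun _ => a)
  have hΨcont : Continuous Ψ := hΨ1.continuous
  -- derivatives of the test field
  have hDΨ : ∀ y w, fderiv ℝ Ψ y w = (fderiv ℝ φ y w) • a := fun y w => by
    simp only [hΨ_def]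
    rw [fderiv_smul_const (hφ1.differentiable one_ne_zero y), ContinuousLinearMap.smulRight_apply]
  have hΔΨ : ∀ y, (Δ Ψ) y = (Δ φ) y • a := fun y => by
    have e : Ψ = (ContinuousLinearMap.toSpanSingleton ℝ a) ∘ φ := by
      funext w; simp [hΨ_def, ContinuousLinearMap.toSpanSingleton_apply]
    rw [e, hφ2.contDiffAt.laplacian_CLM_comp_left]
    simp [ContinuousLinearMap.toSpanSingleton_apply]
  -- continuity of the slices entering the momentum equation
  have hΔuc : Continuous (Δ (u t)) := FluidPDE.continuous_laplacian hu2
  have hdtc : Continuous (FluidPDE.timeDerivWithin (Icc 0 T) u t) :=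
    ((h.smooth_velocity.timeDerivWithin hS).contDiff_slice htI).continuous
  have hcvc : Continuous (FluidPDE.convect (u t) (u t)) :=
    (hu1.continuous_fderiv one_ne_zero).clm_apply huc
  -- Step 1: the mean-value formula for the gradient of the harmonic part
  rw [fderiv_harmonic_eq_integral_probeBump hη hR x₀ a]
  -- Step 2: split into the pressure and the potential parts
  have hDχc : Continuous fun z => fderiv ℝ χ z a :=
    (hχ1.continuous_fderiv one_ne_zero).clm_apply continuous_const
  have hDχs : HasCompactSupport fun z => fderiv ℝ χ z a := hχc.fderiv_apply (𝕜 := ℝ) a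
  have iP : Integrable fun z => fderiv ℝ χ z a * p t (x₀ - z) :=
    (hDχc.mul (hp.continuous.comp (continuous_const.sub continuous_id))).integrable_of_hasCompactSupport
      hDχs.mul_right
  have iQ : Integrable fun z => fderiv ℝ χ z a * Q (x₀ - z) :=
    (hDχc.mul (hQc.comp (continuous_const.sub continuous_id))).integrable_of_hasCompactSupport
      hDχs.mul_right
  have e2 : ∫ z, fderiv ℝ χ z a * (p t (x₀ - z) - Q (x₀ - z)) =
      (∫ z, fderiv ℝ χ z a * p t (x₀ - z)) - ∫ z, fderiv ℝ χ z a * Q (x₀ - z) := by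
    rw [← integral_sub iP iQ]
    refine integral_congr_ae (Eventually.of_forall fun z => ?_)
    simp only [mul_sub]
  rw [e2]
  -- Step 3: the pressure part through the momentum equation
  have iL := FluidPDE.integrable_inner_of_hasCompactSupport_right hΔuc hΨcont hΨc
  have iT := FluidPDE.integrable_inner_of_hasCompactSupport_right hdtc hΨcont hΨc
  have iC := FluidPDE.integrable_inner_of_hasCompactSupport_right hcvc hΨcont hΨc
  have e3 : ∫ z, fderiv ℝ χ z a * p t (x₀ - z) = ∫ y, ⟪gradient (p t) y, Ψ y⟫ := by
    rw [integral_fderiv_mul_comp_sub hχ1 hχc hp1 x₀ a,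
      ← integral_sub_left_eq_self (fun z => χ z * fderiv ℝ (p t) (x₀ - z) a) volume x₀]
    have hg : ∀ y, ⟪gradient (p t) y, a⟫ = fderiv ℝ (p t) y a := fun y => by
      rw [← FluidPDE.inner_gradient_eq_fderiv_apply, real_inner_comm]
    refine integral_congr_ae (Eventually.of_forall fun y => ?_)
    simp only [sub_sub_cancel, hΨ_def, inner_smul_right, hg, hφχ y]
  have e4 : ∫ y, ⟪gradient (p t) y, Ψ y⟫ =
      ν * (∫ y, ⟪(Δ (u t)) y, Ψ y⟫) - (∫ y, ⟪FluidPDE.timeDerivWithin (Icc 0 T) u t y, Ψ y⟫) -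
        ∫ y, ⟪FluidPDE.convect (u t) (u t) y, Ψ y⟫ := by
    have key : ∀ y, ⟪gradient (p t) y, Ψ y⟫ = ν * ⟪(Δ (u t)) y, Ψ y⟫ -
        ⟪FluidPDE.timeDerivWithin (Icc 0 T) u t y, Ψ y⟫ - ⟪FluidPDE.convect (u t) (u t) y, Ψ y⟫ := by
      intro y
      rw [gradient_pressure_eq h htI y, inner_sub_left, inner_sub_left, inner_smul_left]
      simp
    have i2 : Integrable fun y => ν * ⟪(Δ (u t)) y, Ψ y⟫ := iL.const_mul ν
    have i1 : Integrable fun y => ν * ⟪(Δ (u t)) y, Ψ y⟫ -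
        ⟪FluidPDE.timeDerivWithin (Icc 0 T) u t y, Ψ y⟫ := i2.sub iT
    rw [integral_congr_ae (Eventually.of_forall key), integral_sub i1 iC, integral_sub i2 iT,
      integral_const_mul]
  -- Green's identity for the viscous term
  have e5 : ∫ y, ⟪(Δ (u t)) y, Ψ y⟫ = ∫ y, ⟪u t y, (Δ φ) y • a⟫ := by
    rw [FluidPDE.integral_inner_laplacian_comm hu2 hΨ2 hΨc]
    exact integral_congr_ae (Eventually.of_forall fun y => by
      show ⟪u t y, (Δ Ψ) y⟫ = ⟪u t y, (Δ φ) y • a⟫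
      rw [hΔΨ y])
  -- the trilinear identity for the transport term
  have e6 : ∫ y, ⟪FluidPDE.convect (u t) (u t) y, Ψ y⟫ =
      -∫ y, ⟪u t y, fderiv ℝ φ y (u t y) • a⟫ := by
    have h0 := FluidPDE.integral_inner_convect_add_eq_zero hu1 hu1 hΨ1 hΨc
    have hz : ∫ y, VectorCalculus.divergence (u t) y * ⟪u t y, Ψ y⟫ = 0 := by
      simp [h.divFree t htI _]
    have hc : ∫ y, ⟪u t y, FluidPDE.convect (u t) Ψ y⟫ = ∫ y, ⟪u t y, fderiv ℝ φ y (u t y) • a⟫ :=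
      integral_congr_ae (Eventually.of_forall fun y => by simp only [FluidPDE.convect, hDΨ])
    linarith
  rw [e3, e4, e5, e6]
  ring


/-! ### `∇h(t) = 0` on the decay class -/

/-- **`∇h(t) = 0` at interior times for the Type I decay class** (Tao 2011, §4, proof of
Lemma 4.1 (i), conclusion, with the energy replaced by the decay constant): for a classical
solution of the unforced system on `[0, T]` with `(1+|y|)|u(t,y)| ≤ C` for all `t ∈ [0,T]`, the
harmonic part `h(t) = p(t) − Q[u(t)]` has vanishing derivative at every point, for every
`t ∈ (0, T)`: the probe identity gives `∂ₐh(t,x₀) = −W_R'(t) + O((C + C²)/R)` with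
`|W_R| = O(C/R)` uniformly in `t` (constants depending on `x₀`, `a`), and the real-variable
uniqueness lemma of `HarmonicProbe` concludes. [cite: Tao2011, §4, proof of Lemma 4.1 (i)] -/
theorem fderiv_harmonicPart_eq_zero_decay (hν : 0 ≤ ν)
    (h : FluidPDE.IsClassicalNSSolutionOn (Icc 0 T) ν 0 u p) {C : ℝ} (hC : 0 ≤ C)
    (hdec : ∀ t ∈ Icc 0 T, ∀ y, ‖u t y‖ ≤ C / (1 + ‖y‖)) (x₀ a : ℝ³) :
    ∀ t ∈ Ioo 0 T, fderiv ℝ (fun x => p t x - pressurePotential (u t) x) x₀ a = 0 := by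
  -- the constants of the four probe bounds
  obtain ⟨K₁, hK₁0, hK₁⟩ := exists_bound_probe_laplacian_decay a x₀
  obtain ⟨K₂, hK₂0, hK₂⟩ := exists_bound_probe_transport_decay a x₀
  obtain ⟨K₃, hK₃0, hK₃⟩ := exists_bound_probe_boundary_decay a x₀
  obtain ⟨K₄, hK₄0, hK₄⟩ := exists_bound_probe_potential_decay a
  set D : ℝ := C + C ^ 2 with hD
  have hD0 : 0 ≤ D := by positivity
  have hCD : C ≤ D := by rw [hD]; nlinarith
  have hC2D : C ^ 2 ≤ D := by rw [hD]; nlinarith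
  obtain ⟨K, hK⟩ : ∃ K : ℝ, K = (ν * K₁ + K₂ + K₃ + K₄) * D := ⟨_, rfl⟩
  have hKnn : 0 ≤ K := by rw [hK]; positivity
  have hνK : 0 ≤ ν * K₁ := mul_nonneg hν hK₁0
  have hK3le : K₃ * D ≤ K := by
    rw [hK]
    exact mul_le_mul_of_nonneg_right (by linarith) hD0
  have hK124le : (ν * K₁ + K₂ + K₄) * D ≤ K := by
    rw [hK]
    exact mul_le_mul_of_nonneg_right (by linarith) hD0
  refine eq_zero_of_approx_antiderivative fun ε hε => ?_
  -- vacuous unless `0 < T`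
  by_cases hT : 0 < T
  swap
  · exact ⟨0, 0, continuousOn_const, fun t ht => absurd (ht.1.trans ht.2) hT,
      fun t ht => absurd (ht.1.trans ht.2) hT, fun t ht => absurd (ht.1.trans ht.2) hT⟩
  -- the scale `R ≥ 1` with `K/R ≤ ε`
  obtain ⟨R, hR⟩ : ∃ R : ℝ, R = max 1 (K / ε) := ⟨_, rfl⟩
  have hR1 : 1 ≤ R := by rw [hR]; exact le_max_left _ _
  have hR0 : 0 < R := one_pos.trans_le hR1
  have hRi : 0 ≤ R⁻¹ := inv_nonneg.2 hR0.le
  have hKR : K * R⁻¹ ≤ ε := by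
    rw [← div_eq_mul_inv, div_le_iff₀ hR0]
    calc K = K / ε * ε := by field_simp
      _ ≤ R * ε := by gcongr; rw [hR]; exact le_max_right _ _
      _ = ε * R := mul_comm _ _
  -- the test field and the boundary term
  have hΨs : ContDiff ℝ ∞ fun y : ℝ³ => probeBump R (y - x₀) • a :=
    ((contDiff_probeBump (E := ℝ³) R).comp (contDiff_id.sub contDiff_const)).smul contDiff_const
  have hΨc : HasCompactSupport fun y : ℝ³ => probeBump R (y - x₀) • a := by
    have h1 : HasCompactSupport fun y : ℝ³ => probeBump R (y - x₀) := by
      have e : (fun y : ℝ³ => probeBump R (y - x₀)) = probeBump R ∘ Homeomorph.addRight (-x₀) := by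
        funext y; simp [sub_eq_add_neg]
      rw [e]
      exact (hasCompactSupport_probeBump hR0).comp_homeomorph _
    exact h1.smul_right (f' := fun _ => a)
  refine ⟨fun s => ∫ y, ⟪u s y, probeBump R (y - x₀) • a⟫,
    fun s => ∫ y, ⟪FluidPDE.timeDerivWithin (Icc 0 T) u s y, probeBump R (y - x₀) • a⟫,
    (continuousOn_integral_inner_timeDerivWithin hT h hΨs.continuous hΨc).mono Ioo_subset_Icc_self,
    fun t ht => hasDerivAt_integral_inner_velocity h hΨs hΨc ht, fun t ht => ?_, fun t ht => ?_⟩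
  · -- `|W| ≤ ε`
    have htI : t ∈ Icc 0 T := Ioo_subset_Icc_self ht
    have hb := hK₃ (u t) C (h.contDiff_velocity htI).continuous (hdec t htI) R hR1
    calc |∫ y, ⟪u t y, probeBump R (y - x₀) • a⟫| ≤ K₃ * C * R⁻¹ := hb
      _ ≤ K₃ * D * R⁻¹ := by gcongr
      _ ≤ K * R⁻¹ := mul_le_mul_of_nonneg_right hK3le hRi
      _ ≤ ε := hKR
  · -- `|g + W'| ≤ ε`
    have htI : t ∈ Icc 0 T := Ioo_subset_Icc_self ht
    have huc : Continuous (u t) := (h.contDiff_velocity htI).continuous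
    have hu2 : ContDiff ℝ 2 (u t) := contDiff_infty.1 (h.contDiff_velocity htI) 2
    have b1 := hK₁ (u t) C huc (hdec t htI) R hR1
    have b2 := hK₂ (u t) C huc (hdec t htI) R hR1
    have b4 := hK₄ (u t) C hu2 (hdec t htI) R hR1 x₀
    have key := fderiv_harmonicPart_eq_decay h ht (hdec t htI) hR0 x₀ a
    rw [key]
    dsimp only
    generalize (∫ y, ⟪u t y, (Δ (fun y => probeBump R (y - x₀))) y • a⟫) = A at b1 ⊢
    generalize (∫ y, ⟪u t y, fderiv ℝ (fun y => probeBump R (y - x₀)) y (u t y) • a⟫) = B at b2 ⊢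
    generalize (∫ z, fderiv ℝ (probeBump R) z a * pressurePotential (u t) (x₀ - z)) = D' at b4 ⊢
    generalize (∫ y, ⟪FluidPDE.timeDerivWithin (Icc 0 T) u t y, probeBump R (y - x₀) • a⟫) = C'
    have e : ν * A + B - C' - D' + C' = ν * A + B - D' := by ring
    rw [e]
    calc |ν * A + B - D'| ≤ ν * |A| + |B| + |D'| := by
          calc |ν * A + B - D'| ≤ |ν * A + B| + |D'| := abs_sub _ _
            _ ≤ |ν * A| + |B| + |D'| := by gcongr; exact abs_add_le _ _
            _ = ν * |A| + |B| + |D'| := by rw [abs_mul, abs_of_nonneg hν]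
      _ ≤ ν * (K₁ * C * R⁻¹) + K₂ * C ^ 2 * R⁻¹ + K₄ * C ^ 2 * R⁻¹ := by
          gcongr
      _ ≤ ν * (K₁ * D * R⁻¹) + K₂ * D * R⁻¹ + K₄ * D * R⁻¹ := by
          gcongr
      _ = (ν * K₁ + K₂ + K₄) * D * R⁻¹ := by ring
      _ ≤ K * R⁻¹ := mul_le_mul_of_nonneg_right hK124le hRi
      _ ≤ ε := hKR

/-- **`h(t)` is constant in space at interior times on the decay class**:
`p(t, x) − Q[u(t)](x) = p(t, 0) − Q[u(t)](0)`, i.e. `∇p(t) = ∇Q[u(t)]`, for every `x` and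
`t ∈ (0, T)`. [cite: Tao2011, §4, proof of Lemma 4.1 (i)] -/
theorem pressure_sub_pressurePotential_eq_decay (hν : 0 ≤ ν)
    (h : FluidPDE.IsClassicalNSSolutionOn (Icc 0 T) ν 0 u p) {C : ℝ} (hC : 0 ≤ C)
    (hdec : ∀ t ∈ Icc 0 T, ∀ y, ‖u t y‖ ≤ C / (1 + ‖y‖)) {t : ℝ} (ht : t ∈ Ioo 0 T) (x : ℝ³) :
    p t x - pressurePotential (u t) x = p t 0 - pressurePotential (u t) 0 := by
  have htI : t ∈ Icc 0 T := Ioo_subset_Icc_self ht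
  have hu4 : ContDiff ℝ 4 (u t) := contDiff_infty.1 (h.contDiff_velocity htI) 4
  have hp1 : ContDiff ℝ 1 (p t) := contDiff_infty.1 (h.contDiff_pressure htI) 1
  have hQ : ContDiff ℝ 2 (pressurePotential (u t)) := contDiff_pressurePotential_decay hu4 (hdec t htI)
  have hdiff : Differentiable ℝ fun x => p t x - pressurePotential (u t) x :=
    (hp1.differentiable one_ne_zero).sub (hQ.differentiable two_ne_zero)
  have hzero : ∀ x, fderiv ℝ (fun x => p t x - pressurePotential (u t) x) x = 0 := fun x => by
    ext a
    rw [fderiv_harmonicPart_eq_zero_decay hν h hC hdec x a t ht]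
    rfl
  exact is_const_of_fderiv_eq_zero hdiff hzero x 0

/-- **Gradient form**: `∇p(t) = ∇Q[u(t)]` at interior times, on the decay class. [cite: Tao2011, §4, proof of Lemma 4.1 (i)] -/
theorem gradient_pressure_eq_gradient_pressurePotential_decay (hν : 0 ≤ ν)
    (h : FluidPDE.IsClassicalNSSolutionOn (Icc 0 T) ν 0 u p) {C : ℝ} (hC : 0 ≤ C)
    (hdec : ∀ t ∈ Icc 0 T, ∀ y, ‖u t y‖ ≤ C / (1 + ‖y‖)) {t : ℝ} (ht : t ∈ Ioo 0 T) (x : ℝ³) :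
    gradient (p t) x = gradient (pressurePotential (u t)) x := by
  have htI : t ∈ Icc 0 T := Ioo_subset_Icc_self ht
  have hu4 : ContDiff ℝ 4 (u t) := contDiff_infty.1 (h.contDiff_velocity htI) 4
  have hp1 : ContDiff ℝ 1 (p t) := contDiff_infty.1 (h.contDiff_pressure htI) 1
  have hQ : ContDiff ℝ 2 (pressurePotential (u t)) := contDiff_pressurePotential_decay hu4 (hdec t htI)
  have hfun : (fun x => p t x) = fun x => pressurePotential (u t) x + (p t 0 - pressurePotential (u t) 0) := by
    funext x
    have := pressure_sub_pressurePotential_eq_decay hν h hC hdec ht x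
    linarith
  have : p t = fun x => pressurePotential (u t) x + (p t 0 - pressurePotential (u t) 0) := hfun
  rw [this, gradient, gradient, fderiv_add_const]

/-! ### Application: Type I classical solutions on `[−1, 0)` -/

/-- **The pressure of a classical Type I solution is the Riesz pressure up to a function of
time**: for a classical solution of Navier–Stokes (`ν = 1`, `f = 0`) on `[−1, 0)` with the Type I
bound `|u(x,t)| ≤ C₀/(|x| + √(−t))` (1.10), `∇p(t) = ∇Q[u(t)]` for every `t ∈ (−1, 0)` — the
pressure representation `P = RᵢRⱼ(UⁱUʲ)` "+ a function of time, which without loss of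
generality we take to vanish" used in Lemmas 2.1 / 7.1 of the source, here DERIVED for the
tree's notion of classical solution (arbitrary smooth pressure) from the Type I decay alone
(time translation to `[0, T]`, the decay constant `C₀/min(1, √(−t/2))` on `[(t−1)/2, t/2]`, and
`gradient_pressure_eq_gradient_pressurePotential_decay`). [cite: PineauVicol2026, Lemma 2.1 and Lemma 7.1 (proofs, pp. 9–10 and 23–24)] -/
theorem gradient_pressure_eq_of_typeI {u : ℝ → ℝ³ → ℝ³} {p : ℝ → ℝ³ → ℝ} {C₀ : ℝ}
    (hsol : FluidPDE.IsClassicalNSSolutionOn (Ico (-1) 0) 1 0 u p)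
    (hI : ∀ t ∈ Ico (-1 : ℝ) 0, ∀ x, ‖u t x‖ ≤ C₀ / (‖x‖ + Real.sqrt (-t))) {t : ℝ}
    (ht : t ∈ Ioo (-1 : ℝ) 0) (x : ℝ³) :
    gradient (p t) x = gradient (pressurePotential (u t)) x := by
  obtain ⟨ht1, ht2⟩ := ht
  -- the window `[t₁, t₂] = [(t−1)/2, t/2]` around `t`
  set t₁ : ℝ := (t - 1) / 2 with ht₁
  set t₂ : ℝ := t / 2 with ht₂
  have h1 : -1 < t₁ := by rw [ht₁]; linarith
  have h2 : t₁ < t := by rw [ht₁]; linarith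
  have h3 : t < t₂ := by rw [ht₂]; linarith
  have h4 : t₂ < 0 := by rw [ht₂]; linarith
  set T : ℝ := t₂ - t₁ with hT
  have hT0 : 0 < T := by rw [hT]; linarith
  -- the translated solution on `[0, T]`
  have hsol' : FluidPDE.IsClassicalNSSolutionOn (Icc 0 T) 1 0 (fun s => u (s + t₁)) (fun s => p (s + t₁)) := by
    have h := hsol.comp_add_right t₁
    refine h.mono (fun s hs => ?_) (uniqueDiffOn_Icc hT0)
    simp only [mem_preimage, mem_Ico]
    constructor <;> [linarith [hs.1]; linarith [hs.2]]
  -- the decay constant on the window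
  set δ : ℝ := Real.sqrt (-t₂) with hδ
  have hδ0 : 0 < δ := Real.sqrt_pos.2 (by linarith)
  set m : ℝ := min 1 δ with hm
  have hm0 : 0 < m := lt_min one_pos hδ0
  have hC₀ : 0 ≤ C₀ := by
    have := hI t ⟨ht1.le, ht2⟩ 0
    have hpos : 0 < ‖(0 : ℝ³)‖ + Real.sqrt (-t) := by
      rw [norm_zero, zero_add]; exact Real.sqrt_pos.2 (by linarith)
    exact (div_nonneg_iff.1 ((norm_nonneg _).trans this)).elim (fun h => h.1) fun h => absurd h.2 (not_le.2 hpos)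
  have hdec : ∀ s ∈ Icc 0 T, ∀ y, ‖u (s + t₁) y‖ ≤ C₀ / m / (1 + ‖y‖) := by
    intro s hs y
    have hτ : s + t₁ ∈ Ico (-1 : ℝ) 0 := ⟨by linarith [hs.1], by linarith [hs.2]⟩
    have hτ2 : -(s + t₁) ≥ -t₂ := by linarith [hs.2]
    have hsq : δ ≤ Real.sqrt (-(s + t₁)) := Real.sqrt_le_sqrt hτ2
    have hden : m * (1 + ‖y‖) ≤ ‖y‖ + Real.sqrt (-(s + t₁)) := by
      have hm1 : m ≤ 1 := min_le_left _ _
      have hmδ : m ≤ δ := min_le_right _ _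
      nlinarith [norm_nonneg y]
    have hpos : 0 < m * (1 + ‖y‖) := by positivity
    calc ‖u (s + t₁) y‖ ≤ C₀ / (‖y‖ + Real.sqrt (-(s + t₁))) := hI _ hτ y
      _ ≤ C₀ / (m * (1 + ‖y‖)) := div_le_div_of_nonneg_left hC₀ hpos hden
      _ = C₀ / m / (1 + ‖y‖) := by rw [div_div]
  have key := gradient_pressure_eq_gradient_pressurePotential_decay zero_le_one hsol' (by positivity) hdec
    (t := t - t₁) ⟨by linarith, by rw [hT]; linarith⟩ x
  simpa only [sub_add_cancel] using key

end PineauVicol2026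

end Literature.Analysis.FluidPDE
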